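/-
Copyright (c) 2026. Released under Apache 2.0 license as described in the file LICENSE.
Track B ∕ K2-LIT (cell `hodgecm-mathlib`, squad K2, ENGINE E1), crux h413 = `stmt-HodgeConjecture-24833`, route of record `HCCMUnconditional`.
Prover seat `hodgecm-mathlib-K2E3-p12` (g6).  Deal «hsum» (K2E1-plan (g5) 08:27:09Z (2)): the Fourier-side summability letter of ★ p858500 discharged by ★ p858571 + ★ W4.
-/
import Summits.HodgeConjecture.HodgeConjecture.Theorems.K2E1WhittakerBoundsAssemblyU2                    -- ★ p858571 (this seat): `exists_whittaker_continuation_cm_two` (W0 ∧ hWhol ∧ hWbd ∧ hWeq)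
import Summits.HodgeConjecture.HodgeConjecture.Theorems.K2E1WhittakerSeriesConvergenceU2                 -- ★ p858248 W4 (K2E1-p09 g5): `summable_differentiableOn_tsum_of_exp_bounds` (lattice M-test)
import Literature.NumberTheory.Automorphic.TateTruncatedZetaIntegralAnyHaar                               -- ★ `measure_adeleFundamentalDomain_toReal_pos` (`0 < μ(D) < ∞`)
import HarnessLib

/-!
# K2·E1 — `K2E1WhittakerFourierSummableU2`: THE FOURIER-SIDE SUMMABILITY `hsum : Σ_ξ ‖𝓕_μΦ_{g,z}(ξ)‖ < ∞` (`Re z > 1`) OF THE SPHERICAL EISENSTEIN SERIES OF `U(1,1)_{L∕L⁺}` —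
# THE LAST WHITTAKER LETTER OF ★ p858500, FROM ★ p858571 (`hWhol`, `hWbd`, `hWeq`) AND ★ W4'S LATTICE M-TEST (deal «hsum»)

Track B ∕ K2-LIT, crux h413 = `stmt-HodgeConjecture-24833`, route of record `HCCMUnconditional`; cell `hodgecm-mathlib`, squad K2, ENGINE E1.  Prover seat `hodgecm-mathlib-K2E3-p12` (g6).
THEOREMS ONLY (no `def`, no `instance`, no notation, no named-fact hypothesis, no `sorry`); lane `--supports stmt-HodgeConjecture-24833 --as helper` (count-neutral).  Closes no socket.

THE MATHEMATICS [MoeglinWaldspurger1995, II.1.7, I.2.10; Garrett2018, §2.8; CasselsFrohlichANT1967, Ch. XV Thm. 4.1.3].  ★ p858500 `sphericalEisenstein_continuation_cm_two_of_whittaker'` continues `E(φ₀H^z)(g)` given a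
Whittaker function `W` with four letters `hWhol hWbd hWeq hsum`; ★ p858571 `exists_whittaker_continuation_cm_two` produces `W` with the first three (`hWeq` for every additive Haar `μ` of `𝔸_{L⁺}`).
The fourth, `hsum : Σ_ξ ‖𝓕_μΦ_{g,z}(ξ)‖ < ∞` for `Re z > 1`, FOLLOWS: ★ W4 `summable_differentiableOn_tsum_of_exp_bounds` turns `hWhol + hWbd` into `Σ_ξ ‖W(z, ξ)‖ < ∞` on `Re z > ½`, and
`‖𝓕_μΦ_{g,z}(ξ)‖ = μ(D)·‖W(z, ξ)‖` for `ξ ≠ 0` by `hWeq` (`0 < μ(D) < ∞` ★ `measure_adeleFundamentalDomain_toReal_pos`); the single term `ξ = 0` is one `Summable.update`.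
§1 (generic `K`, any family `Φ_z`) **`summable_norm_adeleFourierCoeff_of_whittaker`** — `hsum` from (`hWhol`, `hWbd`, `hWeq`).  §2 (CM pair) **`summable_norm_adeleFourierCoeff_bigCellLine_cm_two`** — ★ p858500's letter
`hsum` BYTE FOR BYTE for `Φ_{g,z}(t) = f_z(ι(w₀)·n(θt)·g)`, `g = n(θx₀)·t₀·k`, every additive Haar `μ` (★ p858571 ∘ §1).  With it ★ p858500 has NO Whittaker letter left: the closing edition is
`obtain ⟨W, -, hWhol, hWbd, hWeq⟩ := exists_whittaker_continuation_cm_two …` + `…_of_whittaker' … W hWhol hWbd (hWeq μ) (summable_norm_adeleFourierCoeff_bigCellLine_cm_two …)` (K2E4-p14's pen).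
HONEST LABEL: HC_CM is proved only modulo the 7 printed citations (2 remaining named inputs: hLiu418 = `stmt-HodgeConjecture-24832`, h413 = `stmt-HodgeConjecture-24833`) until rung 0
closes; this file asserts no named fact and closes no socket.
References: [MoeglinWaldspurger1995] II.1.7, I.2.10 · [Garrett2018] §2.8 · [CasselsFrohlichANT1967] Ch. XV Thm. 4.1.3, Lemma 4.2.4 · [Bump1997] §3.7.
-/

set_option autoImplicit false
-- the mandated namespace repeats the single-problem summit's segment (`HodgeConjecture.HodgeConjecture`)
set_option linter.dupNamespace false

noncomputable section

open MeasureTheory Measure NumberField NumberField.mixedEmbedding IsDedekindDomain Set Filter Topology Module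
open scoped ENNReal NNReal Classical
open Literature.NumberTheory Literature.NumberTheory.Automorphic Literature.NumberTheory.Automorphic.UnitaryGroup AdelicGroupData
open Summit.HodgeConjecture.HodgeConjecture.Cruxes.H413
open Summit.HodgeConjecture.HodgeConjecture.Cruxes.H413.K2E1BorelEisensteinU
open Summit.HodgeConjecture.HodgeConjecture.Cruxes.H413.K2E1WhittakerBoundsAssemblyU2 (exists_whittaker_continuation_cm_two)
open Summit.HodgeConjecture.HodgeConjecture.Cruxes.H413.K2E1WhittakerSeriesConvergenceU2 (summable_differentiableOn_tsum_of_exp_bounds)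

namespace Summit.HodgeConjecture.HodgeConjecture.Cruxes.H413.K2E1WhittakerFourierSummableU2

/-! ## §1 `hsum` from the Whittaker letters (generic number field `K`) -/

/-- **THE FOURIER-SIDE SUMMABILITY `hsum` FROM THE WHITTAKER LETTERS**: if `W(z, ·)` satisfies W5-A's `hWhol`, `hWbd` on `Re z > ½` and `W(z, ξ) = μ(D)⁻¹·𝓕_μ(Φ_z)(ξ)` for `Re z > 1`, `ξ ≠ 0`
(additive Haar `μ`, Tate's domain `D`, `0 < μ(D) < ∞` ★), then `Σ_ξ ‖𝓕_μ(Φ_z)(ξ)‖ < ∞` for `Re z > 1` (★ W4 lattice M-test gives `Σ_ξ ‖W(z, ξ)‖ < ∞`; the term `ξ = 0` is one update).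
[cite: Garrett2018, §2.8] [cite: MoeglinWaldspurger1995, I.2.10] [cite: CasselsFrohlichANT1967, Ch. XV Thm. 4.1.3] -/
theorem summable_norm_adeleFourierCoeff_of_whittaker (K : Type) [Field K] [NumberField K] [MeasurableSpace (AdeleRing (𝓞 K) K)] [BorelSpace (AdeleRing (𝓞 K) K)]
    (μ : Measure (AdeleRing (𝓞 K) K)) [μ.IsAddHaarMeasure] (Φ : ℂ → AdeleRing (𝓞 K) K → ℂ) {W : ℂ → K → ℂ}
    (hWhol : ∀ ξ : K, ξ ≠ 0 → DifferentiableOn ℂ (fun z => W z ξ) {z : ℂ | 1 / 2 < z.re})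
    (hWbd : ∀ z₀ ∈ {z : ℂ | 1 / 2 < z.re}, ∃ V ∈ 𝓝 z₀, ∃ (M b a : ℝ) (Cf : Set (FiniteAdeleRing (𝓞 K) K)), 0 ≤ M ∧ 0 < b ∧ IsCompact Cf ∧
      ∀ z ∈ V, ∀ ξ : K,
        ‖W z ξ‖ ≤ M * Real.exp (-(b * ‖InfiniteAdeleRing.ringEquiv_mixedSpace K (algebraMap K (AdeleRing (𝓞 K) K) ξ).1‖)) *
          (1 + ‖InfiniteAdeleRing.ringEquiv_mixedSpace K (algebraMap K (AdeleRing (𝓞 K) K) ξ).1‖) ^ a ∧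
        ((algebraMap K (AdeleRing (𝓞 K) K) ξ).2 ∉ Cf → W z ξ = 0))
    (hWeq : ∀ z : ℂ, 1 < z.re → ∀ ξ : K, ξ ≠ 0 → W z ξ = ((μ (adeleFundamentalDomain K)).toReal⁻¹ : ℂ) * adeleFourierCoeff μ (Φ z) ξ)
    {z : ℂ} (hz : 1 < z.re) : Summable fun ξ : K => ‖adeleFourierCoeff μ (Φ z) ξ‖ := by
  have hU : IsOpen {z : ℂ | 1 / 2 < z.re} := Complex.continuous_re.isOpen_preimage _ isOpen_Ioi
  have hsW := (summable_differentiableOn_tsum_of_exp_bounds K hU hWhol hWbd).1 z (show 1 / 2 < z.re by linarith)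
  have hD : 0 < (μ (adeleFundamentalDomain K)).toReal := measure_adeleFundamentalDomain_toReal_pos μ
  refine ((hsW.mul_left (μ (adeleFundamentalDomain K)).toReal).update 0 ‖adeleFourierCoeff μ (Φ z) 0‖).congr fun ξ => ?_
  rcases eq_or_ne ξ 0 with rfl | hξ
  · rw [Function.update_self]
  · rw [Function.update_of_ne hξ, hWeq z hz ξ hξ, norm_mul]
    simp only [norm_inv, Complex.norm_real, Real.norm_eq_abs, abs_of_pos hD]
    rw [← mul_assoc, mul_inv_cancel₀ hD.ne', one_mul]

/-! ## §2 ★ p858500's letter `hsum` at the CM pair -/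

variable (L : Type) [Field L] [NumberField L] [IsCMField L]
  (hij : (((0 : Fin 2) : ℕ)) + 1 = ((1 : Fin 2) : ℕ)) (hN : 2 = 2 * ((0 : Fin 2) : ℕ) + 2)
  {δ : L} (hcδ : IsCMField.complexConj L δ = -δ) (hδ : δ ≠ 0)

include hij hN hcδ hδ in
/-- **`hsum` OF ★ p858500 DISCHARGED**: for the CM pair `(L⁺, L)`, `δ̄ = −δ ≠ 0`, the spherical flat section `f_z = φ₀H^z`, an Iwasawa-decomposed `g = n(θx₀)·t₀·k` and EVERY additive Haar measure `μ`
of `𝔸_{L⁺}`: `Σ_ξ ‖𝓕_μΦ_{g,z}(ξ)‖ < ∞` for `Re z > 1`, `Φ_{g,z}(t) = f_z(ι(w₀)·n(θt)·g)` (★ p858571 `exists_whittaker_continuation_cm_two` ∘ §1).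
[cite: MoeglinWaldspurger1995, II.1.7] [cite: Garrett2018, §2.8] [cite: CasselsFrohlichANT1967, Ch. XV Thm. 4.1.3] -/
theorem summable_norm_adeleFourierCoeff_bigCellLine_cm_two [MeasurableSpace (AdeleRing (𝓞 ↥(maximalRealSubfield L)) ↥(maximalRealSubfield L))] [BorelSpace (AdeleRing (𝓞 ↥(maximalRealSubfield L)) ↥(maximalRealSubfield L))]
    (μ : Measure (AdeleRing (𝓞 ↥(maximalRealSubfield L)) ↥(maximalRealSubfield L))) [μ.IsAddHaarMeasure] (φ₀ : ℂ)
    (t₀ : torusInBorel ↥(maximalRealSubfield L) L (IsCMField.complexConj L) 2) {d : Fin 2 → (AdeleRing (𝓞 L) L)ˣ}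
    (hd : glDiagonal 2 (AdeleRing (𝓞 L) L) d = adelicVal ↥(maximalRealSubfield L) L (IsCMField.complexConj L) 2 _ ((t₀ : borelAdelic ↥(maximalRealSubfield L) L (IsCMField.complexConj L) 2) : (quasiSplit (↥(maximalRealSubfield L)) L (IsCMField.complexConj L) 2).Adelic))
    {x₀ : AdeleRing (𝓞 ↥(maximalRealSubfield L)) ↥(maximalRealSubfield L)} {k g : (quasiSplit (↥(maximalRealSubfield L)) L (IsCMField.complexConj L) 2).Adelic}
    (hk : k ∈ ((standardMaximalCompactGL 2 L).comap (adelicVal ↥(maximalRealSubfield L) L (IsCMField.complexConj L) 2 ((StdForm.antidiagonal 2).over L)) : Subgroup (quasiSplit (↥(maximalRealSubfield L)) L (IsCMField.complexConj L) 2).Adelic))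
    (hg : g = ((middleRootUnipotent hij hN (Multiplicative.ofAdd (traceZeroLine ↥(maximalRealSubfield L) L (IsCMField.complexConj L) hcδ hδ x₀)) : ↥(adelicUnipotent (↥(maximalRealSubfield L)) L (IsCMField.complexConj L) 2)) : (quasiSplit (↥(maximalRealSubfield L)) L (IsCMField.complexConj L) 2).Adelic) * ((t₀ : borelAdelic ↥(maximalRealSubfield L) L (IsCMField.complexConj L) 2) : (quasiSplit (↥(maximalRealSubfield L)) L (IsCMField.complexConj L) 2).Adelic) * k) {z : ℂ} (hz : 1 < z.re) :
    Summable fun ξ : ↥(maximalRealSubfield L) => ‖adeleFourierCoeff μ (fun t : AdeleRing (𝓞 ↥(maximalRealSubfield L)) ↥(maximalRealSubfield L) => flatSectionU (fun _ : (quasiSplit (↥(maximalRealSubfield L)) L (IsCMField.complexConj L) 2).Adelic => φ₀) z (((quasiSplit (↥(maximalRealSubfield L)) L (IsCMField.complexConj L) 2).toAdelic (weylLongU ((IsCMField.complexConj L : L ≃ₐ[↥(maximalRealSubfield L)] L) : L →+* L) (rfl : ((StdForm.antidiagonal 2).over L) = ((StdForm.antidiagonal 2).over L)))) * ((middleRootUnipotent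 hij hN (Multiplicative.ofAdd (traceZeroLine ↥(maximalRealSubfield L) L (IsCMField.complexConj L) hcδ hδ t)) : ↥(adelicUnipotent (↥(maximalRealSubfield L)) L (IsCMField.complexConj L) 2)) : (quasiSplit (↥(maximalRealSubfield L)) L (IsCMField.complexConj L) 2).Adelic) * g)) ξ‖ := by
  obtain ⟨W, -, hWhol, hWbd, hWeq⟩ := exists_whittaker_continuation_cm_two L hij hN hcδ hδ φ₀ t₀ hd hk hg
  exact summable_norm_adeleFourierCoeff_of_whittaker ↥(maximalRealSubfield L) μ
    (fun (z : ℂ) (t : AdeleRing (𝓞 ↥(maximalRealSubfield L)) ↥(maximalRealSubfield L)) => flatSectionU (fun _ : (quasiSplit (↥(maximalRealSubfield L)) L (IsCMField.complexConj L) 2).Adelic => φ₀) z (((quasiSplit (↥(maximalRealSubfield L)) L (IsCMField.complexConj L) 2).toAdelic (weylLongU ((IsCMField.complexConj L : L ≃ₐ[↥(maximalRealSubfield L)] L) : L →+* L) (rfl : ((StdForm.antidiagonal 2).over L) = ((StdForm.antidiagonal 2).over L)))) * ((middleRootUnipotent hij hN (Multiplicative.ofAdd (traceZeroLine ↥(maximalRealSubfield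 L) L (IsCMField.complexConj L) hcδ hδ t)) : ↥(adelicUnipotent (↥(maximalRealSubfield L)) L (IsCMField.complexConj L) 2)) : (quasiSplit (↥(maximalRealSubfield L)) L (IsCMField.complexConj L) 2).Adelic) * g)) hWhol hWbd (fun z hz ξ hξ => hWeq μ z hz ξ hξ) hz

end Summit.HodgeConjecture.HodgeConjecture.Cruxes.H413.K2E1WhittakerFourierSummableU2

end
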